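import Summits.NavierStokesRegularity.NavierStokesRegularity.Theorems.PerpetualPumpThesisTameDuhamelBoundRegions
import Literature.Analysis.FunctionSpaces.LittlewoodPaleyConvergenceProofs

/-!
# Stub `tameDuhamelBound` for `PerpetualPump.Thesis`, part V: summing the pieces

Support file (part 5 of the stub `tameDuhamelBound` of line `SketchIdeator2`, crux
stmt-NavierStokesRegularity-1832). The region bounds of part IV for the pieces
`T_{jk} = ⟨B(P_jF, P_kG), H⟩` of Tao's Euler form are summed over `(j,k) ∈ ℤ²`:

* high region `k ≥ j+3`: `∑_j ‖Δ̇_jF‖_∞ · ∑_k g_k h_k` with the almost-orthogonal families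
  `g_k = ‖1_{ann_k}⟨ξ⟩^{10}Ĝ‖₂`, `h_k = ‖1_{A_k}⟨ξ⟩^{-9}Ĥ‖₂` (Cauchy–Schwarz in `k` and the finite
  overlap of the dyadic annuli, `FB.tsum_indicator_annulus_le`, `FB.tsum_mul_le_of_overlap`);
* low region `j ≥ k+3`: the same with `F ↔ G` (symmetry of the Euler form);
* diagonal `|j-k| ≤ 2`: five terms per `j`.

The result is `FB.tsum_tsum_enorm_pieces_le`:
`∑_j ∑_k |T_{jk}| ≤ K (‖F‖_{Ḃ⁰_{∞,1}} ‖G‖_{H¹⁰} + ‖F‖_{H¹⁰} ‖G‖_{Ḃ⁰_{∞,1}}) ‖H‖_{H⁻⁹}` with a finite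
universal constant `K` — the tame (Moser / Kato–Ponce type) structure of the paraproduct estimate
(BCD §2.6–2.8).

## References

* H. Bahouri, J.-Y. Chemin, R. Danchin, *Fourier Analysis and Nonlinear PDE* (2011), §2.6.1,
  Cor. 2.86.
* T. Tao, J. Amer. Math. Soc. 29 (2016), 601–674, §1.1 (1.3).
-/

noncomputable section

open MeasureTheory Filter Topology FourierTransform Real Complex
open scoped SchwartzMap ENNReal NNReal FourierTransform

set_option linter.dupNamespace false

namespace Summit.NavierStokesRegularity.NavierStokesRegularity.Theorems.PerpetualPumpThesis.FB

open Literature.Analysis.FunctionSpaces Literature.Analysis.FluidPDE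
  Literature.Analysis.FluidPDE.Tao2016

/-! ### Finite overlap of the dyadic annuli -/

/-- **Finite overlap of the dyadic annuli**: every frequency `ξ` lies in at most `4n - 1` of the
annuli `{2^{k-n} < |ξ| < 2^{k+n}}`, `k ∈ ℤ` (`n ≥ 1`). -/
theorem tsum_indicator_annulus_le (n : ℕ) (hn : 1 ≤ n) (ξ : EuclideanSpace ℝ (Fin 3)) :
    ∑' k : ℤ, {ξ : EuclideanSpace ℝ (Fin 3) | (2 : ℝ) ^ (k - n) < ‖ξ‖ ∧ ‖ξ‖ < (2 : ℝ) ^ (k + n)}.indicator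
      (fun _ => (1 : ℝ≥0∞)) ξ ≤ ((4 * n - 1 : ℕ) : ℝ≥0∞) := by
  by_cases h : ∃ k₀ : ℤ, ξ ∈ {ξ : EuclideanSpace ℝ (Fin 3) | (2 : ℝ) ^ (k₀ - n) < ‖ξ‖ ∧ ‖ξ‖ < (2 : ℝ) ^ (k₀ + n)}
  · obtain ⟨k₀, hk₀⟩ := h
    set s : Finset ℤ := Finset.Icc (k₀ - (2 * n - 1)) (k₀ + (2 * n - 1)) with hs
    have hmem : ∀ k : ℤ, ξ ∈ {ξ : EuclideanSpace ℝ (Fin 3) | (2 : ℝ) ^ (k - n) < ‖ξ‖ ∧ ‖ξ‖ < (2 : ℝ) ^ (k + n)} →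
        k ∈ s := by
      intro k hk
      have h1 : (2 : ℝ) ^ (k - n) < (2 : ℝ) ^ (k₀ + n) := hk.1.trans hk₀.2
      have h2 : (2 : ℝ) ^ (k₀ - n) < (2 : ℝ) ^ (k + n) := hk₀.1.trans hk.2
      rw [zpow_lt_zpow_iff_right₀ one_lt_two] at h1 h2
      rw [hs, Finset.mem_Icc]
      omega
    have hzero : ∀ k ∉ s, {ξ : EuclideanSpace ℝ (Fin 3) | (2 : ℝ) ^ (k - n) < ‖ξ‖ ∧ ‖ξ‖ < (2 : ℝ) ^ (k + n)}.indicator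
        (fun _ => (1 : ℝ≥0∞)) ξ = 0 := fun k hk =>
      Set.indicator_of_notMem (fun hmk => hk (hmem k hmk)) _
    rw [tsum_eq_sum hzero]
    calc ∑ k ∈ s, {ξ : EuclideanSpace ℝ (Fin 3) | (2 : ℝ) ^ (k - n) < ‖ξ‖ ∧ ‖ξ‖ < (2 : ℝ) ^ (k + n)}.indicator
          (fun _ => (1 : ℝ≥0∞)) ξ
        ≤ ∑ k ∈ s, (1 : ℝ≥0∞) := Finset.sum_le_sum fun k _ => Set.indicator_le_self' (fun _ _ => zero_le_one) ξ
      _ = ((4 * n - 1 : ℕ) : ℝ≥0∞) := by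
          rw [Finset.sum_const, nsmul_eq_mul, mul_one, hs, Int.card_Icc]
          congr 1
          omega
  · push Not at h
    have hzero : ∀ k : ℤ, {ξ : EuclideanSpace ℝ (Fin 3) | (2 : ℝ) ^ (k - n) < ‖ξ‖ ∧ ‖ξ‖ < (2 : ℝ) ^ (k + n)}.indicator
        (fun _ => (1 : ℝ≥0∞)) ξ = 0 := fun k => Set.indicator_of_notMem (h k) _
    simp [hzero]

/-- Set integrals as integrals against the indicator. -/
theorem setLIntegral_eq_lintegral_indicator_mul {S : Set (EuclideanSpace ℝ (Fin 3))} (hS : MeasurableSet S)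
    (f : EuclideanSpace ℝ (Fin 3) → ℝ≥0∞) :
    ∫⁻ ξ in S, f ξ = ∫⁻ ξ, S.indicator (fun _ => (1 : ℝ≥0∞)) ξ * f ξ := by
  rw [← lintegral_indicator hS]
  refine lintegral_congr fun ξ => ?_
  by_cases hξ : ξ ∈ S
  · rw [Set.indicator_of_mem hξ, Set.indicator_of_mem hξ, one_mul]
  · rw [Set.indicator_of_notMem hξ, Set.indicator_of_notMem hξ, zero_mul]

/-- **Almost orthogonality of the annular energies**: for a measurable weight `w`,
`∑_k ∫_{2^{k-n}<|ξ|<2^{k+n}} w |Ĝ|² ≤ (4n-1) ∫ w |Ĝ|²`. -/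
theorem tsum_setLIntegral_annulus_le (n : ℕ) (hn : 1 ≤ n) (G : L2C)
    {w : EuclideanSpace ℝ (Fin 3) → ℝ≥0∞} (hw : Measurable w) :
    ∑' k : ℤ, ∫⁻ ξ in {ξ : EuclideanSpace ℝ (Fin 3) | (2 : ℝ) ^ (k - n) < ‖ξ‖ ∧ ‖ξ‖ < (2 : ℝ) ^ (k + n)},
        w ξ * ‖fourierFn G ξ‖ₑ ^ 2 ≤
      ((4 * n - 1 : ℕ) : ℝ≥0∞) * ∫⁻ ξ, w ξ * ‖fourierFn G ξ‖ₑ ^ 2 := by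
  have hmeas : ∀ k : ℤ, AEMeasurable (fun ξ => {ξ : EuclideanSpace ℝ (Fin 3) |
      (2 : ℝ) ^ (k - n) < ‖ξ‖ ∧ ‖ξ‖ < (2 : ℝ) ^ (k + n)}.indicator (fun _ => (1 : ℝ≥0∞)) ξ *
        (w ξ * ‖fourierFn G ξ‖ₑ ^ 2)) volume := fun k =>
    ((measurable_const.indicator (measurableSet_annulus _ _)).aemeasurable).mul
      (hw.aemeasurable.mul ((aestronglyMeasurable_fourierFn G).enorm.pow_const 2))
  simp_rw [setLIntegral_eq_lintegral_indicator_mul (measurableSet_annulus _ _)]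
  rw [← lintegral_tsum hmeas, ← lintegral_const_mul' _ _ (ENNReal.natCast_ne_top _)]
  refine lintegral_mono fun ξ => ?_
  rw [ENNReal.tsum_mul_right]
  exact mul_le_mul' (tsum_indicator_annulus_le n hn ξ) le_rfl

/-! ### Cauchy–Schwarz over the scales -/

/-- **Cauchy–Schwarz in the scale parameter**: `∑_k a_k^{1/2} b_k^{1/2} ≤ (∑ a_k)^{1/2} (∑ b_k)^{1/2}`
on `ℝ≥0∞` (Hölder for the counting measure on `ℤ`). -/
theorem tsum_rpow_mul_rpow_le (a b : ℤ → ℝ≥0∞) :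
    ∑' k : ℤ, a k ^ (1 / 2 : ℝ) * b k ^ (1 / 2 : ℝ) ≤
      (∑' k : ℤ, a k) ^ (1 / 2 : ℝ) * (∑' k : ℤ, b k) ^ (1 / 2 : ℝ) := by
  have h := ENNReal.lintegral_mul_le_Lp_mul_Lq (Measure.count : Measure ℤ) Real.HolderConjugate.two_two
    (f := fun k => a k ^ (1 / 2 : ℝ)) (g := fun k => b k ^ (1 / 2 : ℝ))
    measurable_from_top.aemeasurable measurable_from_top.aemeasurable
  simp only [Pi.mul_apply, lintegral_count] at h
  have hsq : ∀ x : ℝ≥0∞, (x ^ (1 / 2 : ℝ)) ^ (2 : ℝ) = x := fun x => by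
    rw [← ENNReal.rpow_mul]; norm_num
  simp only [hsq] at h
  exact h

/-- **The almost-orthogonal product sum**: with `g_k² = ∫_{ann_k}⟨ξ⟩^{20}|Ĝ|²` and
`h_k² = ∫_{A_k}⟨η⟩^{-18}|Ĥ|²`, `∑_k g_k h_k ≤ 3^{1/2} · 11^{1/2} ‖G‖_{H¹⁰} ‖H‖_{H⁻⁹}`. -/
theorem tsum_mul_le_of_overlap (G H : L2C) :
    ∑' k : ℤ,
        (∫⁻ ξ in {ξ : EuclideanSpace ℝ (Fin 3) | (2 : ℝ) ^ (k - 1) < ‖ξ‖ ∧ ‖ξ‖ < (2 : ℝ) ^ (k + 1)},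
          ENNReal.ofReal ((1 + ‖ξ‖ ^ 2) ^ (10 : ℝ)) * ‖fourierFn G ξ‖ₑ ^ 2) ^ (1 / 2 : ℝ) *
        (∫⁻ η in {ξ : EuclideanSpace ℝ (Fin 3) | (2 : ℝ) ^ (k - 3) < ‖ξ‖ ∧ ‖ξ‖ < (2 : ℝ) ^ (k + 3)},
          ENNReal.ofReal ((1 + ‖η‖ ^ 2) ^ (-9 : ℝ)) * ‖fourierFn H η‖ₑ ^ 2) ^ (1 / 2 : ℝ) ≤
      (3 : ℝ≥0∞) ^ (1 / 2 : ℝ) * (11 : ℝ≥0∞) ^ (1 / 2 : ℝ) *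
        eFourierSobolevNorm 10 G * eFourierSobolevNorm (-9) H := by
  have h1 := tsum_setLIntegral_annulus_le 1 le_rfl G (measurable_sobolevWeight 10)
  have h3 := tsum_setLIntegral_annulus_le 3 (by norm_num) H (measurable_sobolevWeight (-9))
  rw [show ((4 * 1 - 1 : ℕ) : ℝ≥0∞) = 3 by norm_num] at h1
  rw [show ((4 * 3 - 1 : ℕ) : ℝ≥0∞) = 11 by norm_num] at h3
  simp only [Nat.cast_one] at h1
  simp only [Nat.cast_ofNat] at h3
  refine (tsum_rpow_mul_rpow_le _ _).trans ?_
  rw [eFourierSobolevNorm_eq, eFourierSobolevNorm_eq]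
  unfold sobolevWeightIntegral
  calc (∑' k : ℤ, ∫⁻ ξ in {ξ : EuclideanSpace ℝ (Fin 3) | (2 : ℝ) ^ (k - 1) < ‖ξ‖ ∧ ‖ξ‖ < (2 : ℝ) ^ (k + 1)},
          ENNReal.ofReal ((1 + ‖ξ‖ ^ 2) ^ (10 : ℝ)) * ‖fourierFn G ξ‖ₑ ^ 2) ^ (1 / 2 : ℝ) *
        (∑' k : ℤ, ∫⁻ η in {ξ : EuclideanSpace ℝ (Fin 3) | (2 : ℝ) ^ (k - 3) < ‖ξ‖ ∧ ‖ξ‖ < (2 : ℝ) ^ (k + 3)},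
          ENNReal.ofReal ((1 + ‖η‖ ^ 2) ^ (-9 : ℝ)) * ‖fourierFn H η‖ₑ ^ 2) ^ (1 / 2 : ℝ)
      ≤ (3 * ∫⁻ ξ, ENNReal.ofReal ((1 + ‖ξ‖ ^ 2) ^ (10 : ℝ)) * ‖fourierFn G ξ‖ₑ ^ 2) ^ (1 / 2 : ℝ) *
        (11 * ∫⁻ η, ENNReal.ofReal ((1 + ‖η‖ ^ 2) ^ (-9 : ℝ)) * ‖fourierFn H η‖ₑ ^ 2) ^ (1 / 2 : ℝ) := by
        gcongr
    _ = _ := by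
        rw [ENNReal.mul_rpow_of_nonneg _ _ (by norm_num : (0 : ℝ) ≤ 1 / 2),
          ENNReal.mul_rpow_of_nonneg _ _ (by norm_num : (0 : ℝ) ≤ 1 / 2)]
        ring


/-! ### The pointwise bound by the three regions -/

/-- **Each piece is bounded by the sum of the three region bounds** (high `k ≥ j+3`, low `j ≥ k+3`
via the symmetry `⟨B(X,Y),H⟩ = ⟨B(Y,X),H⟩`, diagonal `|j-k| ≤ 2`). -/
theorem enorm_pieces_le_three {F G : L2C} (H : L2C) (hF : IsFourierDivFree F) (hG : IsFourierDivFree G)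
    (j k : ℤ) :
    ‖eulerForm (fourierMultiplier ((memLp_top_dyadicSymbol (E := EuclideanSpace ℝ (Fin 3)) j).toLp _) F)
        (fourierMultiplier ((memLp_top_dyadicSymbol (E := EuclideanSpace ℝ (Fin 3)) k).toLp _) G) H‖ₑ ≤
      ENNReal.ofReal (72 * π) * 2 ^ 40 * eLpNormDistrib ∞ (lpBlock j ((F : L2C) : 𝓢'(EuclideanSpace ℝ (Fin 3), EuclideanSpace ℂ (Fin 3)))) *
        (∫⁻ ξ in {ξ : EuclideanSpace ℝ (Fin 3) | (2 : ℝ) ^ (k - 1) < ‖ξ‖ ∧ ‖ξ‖ < (2 : ℝ) ^ (k + 1)},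
          ENNReal.ofReal ((1 + ‖ξ‖ ^ 2) ^ (10 : ℝ)) * ‖fourierFn G ξ‖ₑ ^ 2) ^ (1 / 2 : ℝ) *
        (∫⁻ η in {ξ : EuclideanSpace ℝ (Fin 3) | (2 : ℝ) ^ (k - 3) < ‖ξ‖ ∧ ‖ξ‖ < (2 : ℝ) ^ (k + 3)},
          ENNReal.ofReal ((1 + ‖η‖ ^ 2) ^ (-9 : ℝ)) * ‖fourierFn H η‖ₑ ^ 2) ^ (1 / 2 : ℝ) +
      ENNReal.ofReal (72 * π) * 2 ^ 40 * eLpNormDistrib ∞ (lpBlock k ((G : L2C) : 𝓢'(EuclideanSpace ℝ (Fin 3), EuclideanSpace ℂ (Fin 3)))) *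
        (∫⁻ ξ in {ξ : EuclideanSpace ℝ (Fin 3) | (2 : ℝ) ^ (j - 1) < ‖ξ‖ ∧ ‖ξ‖ < (2 : ℝ) ^ (j + 1)},
          ENNReal.ofReal ((1 + ‖ξ‖ ^ 2) ^ (10 : ℝ)) * ‖fourierFn F ξ‖ₑ ^ 2) ^ (1 / 2 : ℝ) *
        (∫⁻ η in {ξ : EuclideanSpace ℝ (Fin 3) | (2 : ℝ) ^ (j - 3) < ‖ξ‖ ∧ ‖ξ‖ < (2 : ℝ) ^ (j + 3)},
          ENNReal.ofReal ((1 + ‖η‖ ^ 2) ^ (-9 : ℝ)) * ‖fourierFn H η‖ₑ ^ 2) ^ (1 / 2 : ℝ) +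
      (if j ≤ k + 2 ∧ k ≤ j + 2 then
        ENNReal.ofReal (72 * π) * 2 ^ 80 * eLpNormDistrib ∞ (lpBlock j ((F : L2C) : 𝓢'(EuclideanSpace ℝ (Fin 3), EuclideanSpace ℂ (Fin 3)))) *
          eFourierSobolevNorm 10 G * eFourierSobolevNorm (-9) H
       else 0) := by
  by_cases h1 : j + 3 ≤ k
  · exact le_add_right (le_add_right (enorm_eulerForm_pieces_le_hi H hF hG h1))
  by_cases h2 : k + 3 ≤ j
  · rw [eulerForm_symm]
    exact le_add_right (le_add_left (enorm_eulerForm_pieces_le_hi H hG hF h2))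
  · have h3 : j ≤ k + 2 ∧ k ≤ j + 2 := by omega
    rw [if_pos h3]
    exact le_add_left (enorm_eulerForm_pieces_le_diag H hF hG h3.1 h3.2)

/-- Five scales interact diagonally with a given one: `∑_k 1_{|j-k| ≤ 2} R ≤ 5 R`. -/
theorem tsum_ite_diag_le (j : ℤ) (R : ℝ≥0∞) :
    ∑' k : ℤ, (if j ≤ k + 2 ∧ k ≤ j + 2 then R else 0) ≤ 5 * R := by
  have hzero : ∀ k ∉ Finset.Icc (j - 2) (j + 2), (if j ≤ k + 2 ∧ k ≤ j + 2 then R else 0) = 0 := by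
    intro k hk
    rw [Finset.mem_Icc] at hk
    rw [if_neg]
    omega
  rw [tsum_eq_sum hzero]
  calc ∑ k ∈ Finset.Icc (j - 2) (j + 2), (if j ≤ k + 2 ∧ k ≤ j + 2 then R else 0)
      ≤ ∑ k ∈ Finset.Icc (j - 2) (j + 2), R := Finset.sum_le_sum fun k _ => by split_ifs <;> simp
    _ = 5 * R := by
        rw [Finset.sum_const, nsmul_eq_mul, Int.card_Icc]
        congr 1
        rw [show (j + 2 + 1 - (j - 2)).toNat = 5 by omega]
        norm_num

/-! ### The double sum -/

/-- **The tame double-sum bound**: for divergence-free `F, G ∈ L²(ℝ³; ℂ³)` and `H ∈ L²`,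
`∑_j ∑_k |⟨B(P_jF, P_kG), H⟩| ≤ K (‖F‖_{Ḃ⁰_{∞,1}} ‖G‖_{H¹⁰} + ‖F‖_{H¹⁰} ‖G‖_{Ḃ⁰_{∞,1}}) ‖H‖_{H⁻⁹}`
with the universal constant `K = 72π (2⁴⁰ √3 √11 + 5 · 2⁸⁰)`. -/
theorem tsum_tsum_enorm_pieces_le {F G : L2C} (H : L2C) (hF : IsFourierDivFree F) (hG : IsFourierDivFree G) :
    ∑' j : ℤ, ∑' k : ℤ, ‖eulerForm (fourierMultiplier ((memLp_top_dyadicSymbol (E := EuclideanSpace ℝ (Fin 3)) j).toLp _) F)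
        (fourierMultiplier ((memLp_top_dyadicSymbol (E := EuclideanSpace ℝ (Fin 3)) k).toLp _) G) H‖ₑ ≤
      (ENNReal.ofReal (72 * π) * 2 ^ 40 * (3 : ℝ≥0∞) ^ (1 / 2 : ℝ) * (11 : ℝ≥0∞) ^ (1 / 2 : ℝ) +
          5 * (ENNReal.ofReal (72 * π) * 2 ^ 80)) *
        (eHomBesovNorm 0 ∞ 1 ((F : L2C) : 𝓢'(EuclideanSpace ℝ (Fin 3), EuclideanSpace ℂ (Fin 3))) * eFourierSobolevNorm 10 G +
          eFourierSobolevNorm 10 F * eHomBesovNorm 0 ∞ 1 ((G : L2C) : 𝓢'(EuclideanSpace ℝ (Fin 3), EuclideanSpace ℂ (Fin 3)))) *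
        eFourierSobolevNorm (-9) H := by
  set C₁ : ℝ≥0∞ := ENNReal.ofReal (72 * π) * 2 ^ 40 with hC₁
  set C₃ : ℝ≥0∞ := ENNReal.ofReal (72 * π) * 2 ^ 80 with hC₃
  set X : ℝ≥0∞ := (3 : ℝ≥0∞) ^ (1 / 2 : ℝ) * (11 : ℝ≥0∞) ^ (1 / 2 : ℝ) with hX
  set βF : ℤ → ℝ≥0∞ := fun j => eLpNormDistrib ∞ (lpBlock j ((F : L2C) : 𝓢'(EuclideanSpace ℝ (Fin 3), EuclideanSpace ℂ (Fin 3)))) with hβF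
  set βG : ℤ → ℝ≥0∞ := fun k => eLpNormDistrib ∞ (lpBlock k ((G : L2C) : 𝓢'(EuclideanSpace ℝ (Fin 3), EuclideanSpace ℂ (Fin 3)))) with hβG
  set gF : ℤ → ℝ≥0∞ := fun j => (∫⁻ ξ in {ξ : EuclideanSpace ℝ (Fin 3) | (2 : ℝ) ^ (j - 1) < ‖ξ‖ ∧ ‖ξ‖ < (2 : ℝ) ^ (j + 1)},
          ENNReal.ofReal ((1 + ‖ξ‖ ^ 2) ^ (10 : ℝ)) * ‖fourierFn F ξ‖ₑ ^ 2) ^ (1 / 2 : ℝ) with hgF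
  set gG : ℤ → ℝ≥0∞ := fun k => (∫⁻ ξ in {ξ : EuclideanSpace ℝ (Fin 3) | (2 : ℝ) ^ (k - 1) < ‖ξ‖ ∧ ‖ξ‖ < (2 : ℝ) ^ (k + 1)},
          ENNReal.ofReal ((1 + ‖ξ‖ ^ 2) ^ (10 : ℝ)) * ‖fourierFn G ξ‖ₑ ^ 2) ^ (1 / 2 : ℝ) with hgG
  set hH : ℤ → ℝ≥0∞ := fun k => (∫⁻ η in {ξ : EuclideanSpace ℝ (Fin 3) | (2 : ℝ) ^ (k - 3) < ‖ξ‖ ∧ ‖ξ‖ < (2 : ℝ) ^ (k + 3)},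
          ENNReal.ofReal ((1 + ‖η‖ ^ 2) ^ (-9 : ℝ)) * ‖fourierFn H η‖ₑ ^ 2) ^ (1 / 2 : ℝ) with hhH
  have hsumF : ∑' j : ℤ, βF j = eHomBesovNorm 0 ∞ 1 ((F : L2C) : 𝓢'(EuclideanSpace ℝ (Fin 3), EuclideanSpace ℂ (Fin 3))) := (eHomBesovNorm_zero_one_eq_tsum ∞ _).symm
  have hsumG : ∑' k : ℤ, βG k = eHomBesovNorm 0 ∞ 1 ((G : L2C) : 𝓢'(EuclideanSpace ℝ (Fin 3), EuclideanSpace ℂ (Fin 3))) := (eHomBesovNorm_zero_one_eq_tsum ∞ _).symm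
  have hGH : ∑' k : ℤ, gG k * hH k ≤ X * eFourierSobolevNorm 10 G * eFourierSobolevNorm (-9) H :=
    tsum_mul_le_of_overlap G H
  have hFH : ∑' j : ℤ, gF j * hH j ≤ X * eFourierSobolevNorm 10 F * eFourierSobolevNorm (-9) H :=
    tsum_mul_le_of_overlap F H
  -- the pointwise bound in the abbreviated form
  have hpt : ∀ j k : ℤ, ‖eulerForm (fourierMultiplier ((memLp_top_dyadicSymbol (E := EuclideanSpace ℝ (Fin 3)) j).toLp _) F)
        (fourierMultiplier ((memLp_top_dyadicSymbol (E := EuclideanSpace ℝ (Fin 3)) k).toLp _) G) H‖ₑ ≤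
      C₁ * βF j * gG k * hH k + C₁ * βG k * gF j * hH j +
        (if j ≤ k + 2 ∧ k ≤ j + 2 then C₃ * βF j * eFourierSobolevNorm 10 G * eFourierSobolevNorm (-9) H
         else 0) := fun j k => enorm_pieces_le_three H hF hG j k
  -- the three double sums
  have hS₁ : ∑' j : ℤ, ∑' k : ℤ, C₁ * βF j * gG k * hH k ≤
      C₁ * X * (eHomBesovNorm 0 ∞ 1 ((F : L2C) : 𝓢'(EuclideanSpace ℝ (Fin 3), EuclideanSpace ℂ (Fin 3))) * eFourierSobolevNorm 10 G) * eFourierSobolevNorm (-9) H := by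
    have he : ∀ j : ℤ, ∑' k : ℤ, C₁ * βF j * gG k * hH k = C₁ * βF j * ∑' k : ℤ, gG k * hH k := by
      intro j
      rw [← ENNReal.tsum_mul_left]
      exact tsum_congr fun k => by ring
    simp_rw [he]
    rw [ENNReal.tsum_mul_right, ENNReal.tsum_mul_left, hsumF]
    calc C₁ * eHomBesovNorm 0 ∞ 1 ((F : L2C) : 𝓢'(EuclideanSpace ℝ (Fin 3), EuclideanSpace ℂ (Fin 3))) * ∑' k : ℤ, gG k * hH k
        ≤ C₁ * eHomBesovNorm 0 ∞ 1 ((F : L2C) : 𝓢'(EuclideanSpace ℝ (Fin 3), EuclideanSpace ℂ (Fin 3))) * (X * eFourierSobolevNorm 10 G * eFourierSobolevNorm (-9) H) :=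
          mul_le_mul' le_rfl hGH
      _ = _ := by ring
  have hS₂ : ∑' j : ℤ, ∑' k : ℤ, C₁ * βG k * gF j * hH j ≤
      C₁ * X * (eFourierSobolevNorm 10 F * eHomBesovNorm 0 ∞ 1 ((G : L2C) : 𝓢'(EuclideanSpace ℝ (Fin 3), EuclideanSpace ℂ (Fin 3)))) * eFourierSobolevNorm (-9) H := by
    have he : ∀ j : ℤ, ∑' k : ℤ, C₁ * βG k * gF j * hH j = C₁ * (gF j * hH j) * ∑' k : ℤ, βG k := by
      intro j
      rw [← ENNReal.tsum_mul_left]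
      exact tsum_congr fun k => by ring
    simp_rw [he, hsumG]
    rw [ENNReal.tsum_mul_right, ENNReal.tsum_mul_left]
    calc C₁ * (∑' j : ℤ, gF j * hH j) * eHomBesovNorm 0 ∞ 1 ((G : L2C) : 𝓢'(EuclideanSpace ℝ (Fin 3), EuclideanSpace ℂ (Fin 3)))
        ≤ C₁ * (X * eFourierSobolevNorm 10 F * eFourierSobolevNorm (-9) H) * eHomBesovNorm 0 ∞ 1 ((G : L2C) : 𝓢'(EuclideanSpace ℝ (Fin 3), EuclideanSpace ℂ (Fin 3))) :=
          mul_le_mul' (mul_le_mul' le_rfl hFH) le_rfl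
      _ = _ := by ring
  have hS₃ : ∑' j : ℤ, ∑' k : ℤ,
      (if j ≤ k + 2 ∧ k ≤ j + 2 then C₃ * βF j * eFourierSobolevNorm 10 G * eFourierSobolevNorm (-9) H else 0) ≤
      5 * C₃ * (eHomBesovNorm 0 ∞ 1 ((F : L2C) : 𝓢'(EuclideanSpace ℝ (Fin 3), EuclideanSpace ℂ (Fin 3))) * eFourierSobolevNorm 10 G) * eFourierSobolevNorm (-9) H := by
    calc ∑' j : ℤ, ∑' k : ℤ, (if j ≤ k + 2 ∧ k ≤ j + 2 then
          C₃ * βF j * eFourierSobolevNorm 10 G * eFourierSobolevNorm (-9) H else 0)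
        ≤ ∑' j : ℤ, 5 * (C₃ * βF j * eFourierSobolevNorm 10 G * eFourierSobolevNorm (-9) H) :=
          ENNReal.tsum_le_tsum fun j => tsum_ite_diag_le j _
      _ = 5 * C₃ * eFourierSobolevNorm 10 G * eFourierSobolevNorm (-9) H * ∑' j : ℤ, βF j := by
          rw [← ENNReal.tsum_mul_left]
          exact tsum_congr fun j => by ring
      _ = _ := by rw [hsumF]; ring
  -- assemble
  calc ∑' j : ℤ, ∑' k : ℤ, ‖eulerForm (fourierMultiplier ((memLp_top_dyadicSymbol (E := EuclideanSpace ℝ (Fin 3)) j).toLp _) F)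
        (fourierMultiplier ((memLp_top_dyadicSymbol (E := EuclideanSpace ℝ (Fin 3)) k).toLp _) G) H‖ₑ
      ≤ ∑' j : ℤ, ∑' k : ℤ, (C₁ * βF j * gG k * hH k + C₁ * βG k * gF j * hH j +
          (if j ≤ k + 2 ∧ k ≤ j + 2 then C₃ * βF j * eFourierSobolevNorm 10 G * eFourierSobolevNorm (-9) H
           else 0)) := ENNReal.tsum_le_tsum fun j => ENNReal.tsum_le_tsum fun k => hpt j k
    _ = (∑' j : ℤ, ∑' k : ℤ, C₁ * βF j * gG k * hH k) + (∑' j : ℤ, ∑' k : ℤ, C₁ * βG k * gF j * hH j) +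
          ∑' j : ℤ, ∑' k : ℤ, (if j ≤ k + 2 ∧ k ≤ j + 2 then
            C₃ * βF j * eFourierSobolevNorm 10 G * eFourierSobolevNorm (-9) H else 0) := by
        rw [← ENNReal.tsum_add, ← ENNReal.tsum_add]
        refine tsum_congr fun j => ?_
        rw [← ENNReal.tsum_add, ← ENNReal.tsum_add]
    _ ≤ C₁ * X * (eHomBesovNorm 0 ∞ 1 ((F : L2C) : 𝓢'(EuclideanSpace ℝ (Fin 3), EuclideanSpace ℂ (Fin 3))) * eFourierSobolevNorm 10 G) * eFourierSobolevNorm (-9) H +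
        C₁ * X * (eFourierSobolevNorm 10 F * eHomBesovNorm 0 ∞ 1 ((G : L2C) : 𝓢'(EuclideanSpace ℝ (Fin 3), EuclideanSpace ℂ (Fin 3)))) * eFourierSobolevNorm (-9) H +
        5 * C₃ * (eHomBesovNorm 0 ∞ 1 ((F : L2C) : 𝓢'(EuclideanSpace ℝ (Fin 3), EuclideanSpace ℂ (Fin 3))) * eFourierSobolevNorm 10 G) * eFourierSobolevNorm (-9) H :=
        add_le_add (add_le_add hS₁ hS₂) hS₃
    _ ≤ C₁ * X * (eHomBesovNorm 0 ∞ 1 ((F : L2C) : 𝓢'(EuclideanSpace ℝ (Fin 3), EuclideanSpace ℂ (Fin 3))) * eFourierSobolevNorm 10 G) * eFourierSobolevNorm (-9) H +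
        C₁ * X * (eFourierSobolevNorm 10 F * eHomBesovNorm 0 ∞ 1 ((G : L2C) : 𝓢'(EuclideanSpace ℝ (Fin 3), EuclideanSpace ℂ (Fin 3)))) * eFourierSobolevNorm (-9) H +
        5 * C₃ * (eHomBesovNorm 0 ∞ 1 ((F : L2C) : 𝓢'(EuclideanSpace ℝ (Fin 3), EuclideanSpace ℂ (Fin 3))) * eFourierSobolevNorm 10 G) * eFourierSobolevNorm (-9) H +
        5 * C₃ * (eFourierSobolevNorm 10 F * eHomBesovNorm 0 ∞ 1 ((G : L2C) : 𝓢'(EuclideanSpace ℝ (Fin 3), EuclideanSpace ℂ (Fin 3)))) * eFourierSobolevNorm (-9) H :=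
        le_add_right le_rfl
    _ = _ := by rw [hC₁, hX]; ring

end Summit.NavierStokesRegularity.NavierStokesRegularity.Theorems.PerpetualPumpThesis.FB

namespace Summit.NavierStokesRegularity.NavierStokesRegularity.Theorems.PerpetualPumpThesis

open MeasureTheory
open Literature.Analysis.FluidPDE Literature.Analysis.FluidPDE.Tao2016
open Literature.Analysis.FunctionSpaces

/-- **Part Sums of stub `tameDuhamelBound` (registered sub-goal `stub_FB_Sums`)**: almost orthogonality
of the dyadic annular energies — with `g_k = ‖1_{2^{k-1}<|ξ|<2^{k+1}}⟨ξ⟩^{10}Ĝ‖₂` and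
`h_k = ‖1_{2^{k-3}<|η|<2^{k+3}}⟨η⟩^{-9}Ĥ‖₂`, `∑_k g_k h_k ≤ √3 √11 ‖G‖_{H¹⁰} ‖H‖_{H⁻⁹}`
(Cauchy–Schwarz over the scales and the finite overlap of the annuli), the summation device of the
high/low regions of the paraproduct estimate. -/
theorem stub_FB_Sums : ∀ (G H : L2C), ∑' k : ℤ, (∫⁻ ξ in {ξ : EuclideanSpace ℝ (Fin 3) | (2 : ℝ) ^ (k - 1) < ‖ξ‖ ∧ ‖ξ‖ < (2 : ℝ) ^ (k + 1)}, ENNReal.ofReal ((1 + ‖ξ‖ ^ 2) ^ (10 : ℝ)) * ‖fourierFn G ξ‖ₑ ^ 2) ^ (1 / 2 : ℝ) * (∫⁻ η in {ξ : EuclideanSpace ℝ (Fin 3) | (2 : ℝ) ^ (k - 3) < ‖ξ‖ ∧ ‖ξ‖ < (2 : ℝ) ^ (k + 3)}, ENNReal.ofReal ((1 + ‖η‖ ^ 2) ^ (-9 : ℝ)) * ‖fourierFn H η‖ₑ ^ 2) ^ (1 / 2 : ℝ) ≤ (3 : ENNReal) ^ (1 / 2 : ℝ) * (11 : ENNReal)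 ^ (1 / 2 : ℝ) * eFourierSobolevNorm 10 G * eFourierSobolevNorm (-9) H :=
  fun G H => FB.tsum_mul_le_of_overlap G H

end Summit.NavierStokesRegularity.NavierStokesRegularity.Theorems.PerpetualPumpThesis
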